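import Summits.QuantumFields.YangMills.Theorems.BalabanUVNodesN15KingModelBoxContinuumDensity
import Summits.QuantumFields.YangMills.Theorems.BalabanUVNodesN15KingModelBoxFreeEnergyDensity
import Summits.QuantumFields.YangMills.Theorems.BalabanUVNodesN15KingModelBoxSpectralBounds
import HarnessLib

/-!
# BalabanUVNodes ∕ N15 — THE KING-MODEL RUNG (PART Ϟ-l, package): PART Ϟ BY NAME — THE SPECTRUM OF KING's FREE-BOUNDARY («Ω») OPERATORS IN THE COSINE BASIS, THE NORMALISATIONS
# (3.89)∕(3.93) ON Ω, AND THE FREE-BOUNDARY THERMODYNAMIC LIMITS (= THE PERIODIC ONES) — TWELVE HEADLINES IN ONE CONJUNCTION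
# (Track A, DAG node N15 = NE2; FAN-OUT v1.1 §N15 s3 «KING-MODEL RUNG»; King p.670 l.8–13 «free boundary conditions»; count-neutral)

HONEST FRAMING.  Count-neutral (cell `pub-ymgap`, seat `pub-ymgap-dag-n15-e` g41; `--supports stmt-QuantumFields-27366 --as helper` = K3⁸).  A PACKAGING file (no new
mathematics): parts Ϟ-a … Ϟ-k by name, for the referees and the consumers.  TEMPLATE LITERATURE: C. King, Commun. Math. Phys. **102** (1986) 649–677 [King1986], §4 p.670 l.8–13
(free boundary conditions on `Ω`), (2.13)–(2.14) p.653, (3.89)–(3.93) pp.668–669, (4.4)–(4.5) p.670.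
★★★ **`king_box_spectral_package`**: for every box `Ω = Π_μ{0,…,n_μ−1}` (all sides ≥ 1), every `N ≥ 1`, `c ≥ 0`, `a, m² > 0`: (1) `boxOp_mulVec_boxWave` (the Neumann eigen-equation);
(2) `sum_boxWave_mul_boxWave` (orthogonality) and (3) `sum_boxWave_mul_boxWave_div_weight` (completeness); (4) `det_boxOp_eq_prod_cos`; (5) `kingBoxGreen_eq_sum_boxWave` (the Neumann
Green's function as a cosine series); (6) `det_foldOp_effLaplacian_eq_prod` (`det Δ^{(K)}_Ω`, `c = N²`); (7) `log_gaussNorm_foldOp_effLaplacian` (King (3.89) on Ω);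
(8) `foldOp_effLaplacian_inv_apply_eq_sum_boxWave` (NE2's unit-layer kernel on Ω as a cosine series); (9) `dotProduct_blockCov_box_bounds` (its exact spectral bounds);
(10) `abs_log_det_lapF_dbl_div_card_sub_box_le` (free vs periodic at finite volume, surface∕volume rate); (11) `abs_log_det_effLaplacian_dbl_div_card_sub_box_le` (the same for
`Δ^{(K)}`); (12) `kingFreeEnergyInf_eq_halfZoneIntegral`.  ★★★ **`king_box_spectral_limits`**: along ANY boxes with all sides `→ ∞`: (1) `tendsto_log_det_boxOp_div_card`;
(2) `tendsto_log_det_foldOp_effLaplacian_div_card`; (3) `tendsto_log_gaussNorm_foldOp_effLaplacian_div_card`.  ★★★ **`king_box_spectral_rates`** (`L` odd `≥ 2`, `K ≥ 1`):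
(1) `abs_log_gaussNorm_foldOp_effLaplacian_sub_lim_le` (King (3.93) on Ω); (2) `blockCov_box_sub_lim_mulVec_sq_le` (NE2's unit layer on Ω in operator norm, rate `L^{−2K}`);
(3) `tendsto_log_det_foldOp_effLaplacianLim_div_card` (the continuum effective Laplacian's density on Ω).

NOT Bałaban's covariant objects; NOT a node discharge (N15 is booked through n15-a's knit, untouched); nothing continuum-YM ∕ `ℝ⁴` ∕ OS ∕ Clay.  0 `sorry`; 0 `def`.
Locators: [King1986] §4 p.670 l.8–13, (2.13)–(2.14) p.653, (3.89)–(3.93) pp.668–669, (4.4)–(4.5) p.670, Lemma 4.3 (4.18) p.672.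
-/

noncomputable section

open scoped BigOperators Topology
open Finset Filter Matrix

namespace Summit.QuantumFields.YangMills.BalabanUVNodes.N15KingModelRung.TorusSpectral

open Literature.MathematicalPhysics.QuantumFieldTheory.Balaban1983to89.B5Prop11Plancherel (Tor sOf)
open Literature.MathematicalPhysics.QuantumFieldTheory.King1986 (aK DeltaEff)
open Literature.MathematicalPhysics.QuantumFieldTheory.King1986.Torus
open Summit.QuantumFields.YangMills.BalabanUVNodes.N15KingModelRung.FreeField (gaussNorm)

variable {d : ℕ}

/-- ★★★ **PART Ϟ BY NAME — KING's FREE-BOUNDARY OPERATORS ON `Ω` IN THE COSINE BASIS, AT FINITE VOLUME.** [cite: King1986, §4 p.670 l.8–13, (2.13)–(2.14) p.653, (3.89) p.668,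
(4.4)–(4.5) p.670] -/
theorem king_box_spectral_package (n : Fin (d + 1) → ℕ) [∀ μ, NeZero (n μ)] (N : ℕ) [NeZero N] {a c m2 : ℝ} (ha : 0 < a) (hc : 0 ≤ c) (hm : 0 < m2) :
    -- (1) the Neumann eigen-equation
    (∀ k : KingBox n, boxOp n c m2 *ᵥ boxWave n k = lapSym (dblPer n) c m2 (dblBox n k) • boxWave n k) ∧
    -- (2) orthogonality of the cosine waves
    (∀ k l : KingBox n, ∑ s : KingBox n, boxWave n k s * boxWave n l s = if k = l then boxWaveWeight n k else 0) ∧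
    -- (3) completeness of the cosine waves
    (∀ s t : KingBox n, ∑ k : KingBox n, boxWave n k s * boxWave n k t / boxWaveWeight n k = if s = t then 1 else 0) ∧
    -- (4) the free determinant with free boundary conditions
    ((boxOp n c m2).det = ∏ k : KingBox n, (m2 + c * ∑ μ, (2 - 2 * Real.cos (Real.pi * (k μ).val / n μ)))) ∧
    -- (5) the Neumann Green's function as a cosine series
    (∀ s t : KingBox n, kingBoxGreen n c m2 s t = ∑ k : KingBox n, boxWave n k s * boxWave n k t / (lapSym (dblPer n) c m2 (dblBox n k) * boxWaveWeight n k)) ∧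
    -- (6) the RG block-field determinant on Ω (`c = N²`)
    ((foldOp n (effLaplacian N (dblPer n) a ((N : ℝ) ^ 2) m2)).det = ∏ k : KingBox n, effSym N (dblPer n) a ((N : ℝ) ^ 2) m2 (dblBox n k)) ∧
    -- (7) King's (3.89) on Ω
    (Real.log (gaussNorm (foldOp n (effLaplacian N (dblPer n) a ((N : ℝ) ^ 2) m2)))
      = (Fintype.card (KingBox n) : ℝ) / 2 * Real.log (2 * Real.pi) - 1 / 2 * ∑ k : KingBox n, Real.log (effSym N (dblPer n) a ((N : ℝ) ^ 2) m2 (dblBox n k))) ∧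
    -- (8) NE2's unit-layer kernel on Ω as a cosine series
    (∀ s t : KingBox n, (foldOp n (effLaplacian N (dblPer n) a ((N : ℝ) ^ 2) m2))⁻¹ s t
      = ∑ k : KingBox n, boxWave n k s * boxWave n k t / (effSym N (dblPer n) a ((N : ℝ) ^ 2) m2 (dblBox n k) * boxWaveWeight n k)) ∧
    -- (9) its exact spectral bounds
    (∀ f : KingBox n → ℝ, a⁻¹ * (f ⬝ᵥ f) ≤ f ⬝ᵥ ((foldOp n (effLaplacian N (dblPer n) a ((N : ℝ) ^ 2) m2))⁻¹ *ᵥ f) ∧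
      f ⬝ᵥ ((foldOp n (effLaplacian N (dblPer n) a ((N : ℝ) ^ 2) m2))⁻¹ *ᵥ f) ≤ (a⁻¹ + m2⁻¹) * (f ⬝ᵥ f)) ∧
    -- (10) free vs periodic at finite volume (free field)
    (|(Fintype.card (Tor (dblPer n)) : ℝ)⁻¹ * Real.log (lapF (dblPer n) c m2).det - (Fintype.card (KingBox n) : ℝ)⁻¹ * Real.log (boxOp n c m2).det|
      ≤ 2 * (|Real.log m2| + |Real.log (m2 + 4 * c * (d + 1))|) * ∑ μ, ((n μ : ℝ))⁻¹) ∧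
    -- (11) free vs periodic at finite volume (RG block field)
    (|(Fintype.card (Tor (dblPer n)) : ℝ)⁻¹ * Real.log (effLaplacian N (dblPer n) a ((N : ℝ) ^ 2) m2).det
        - (Fintype.card (KingBox n) : ℝ)⁻¹ * Real.log (foldOp n (effLaplacian N (dblPer n) a ((N : ℝ) ^ 2) m2)).det|
      ≤ 2 * (|Real.log ((a⁻¹ + m2⁻¹)⁻¹)| + |Real.log a|) * ∑ μ, ((n μ : ℝ))⁻¹) ∧
    -- (12) the infinite-volume free energy density as a half-zone integral
    (kingFreeEnergyInf c m2 d = (Real.pi ^ (d + 1))⁻¹ * halfZoneIntegral c m2 d) :=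
  ⟨boxOp_mulVec_boxWave n c m2,
    sum_boxWave_mul_boxWave n,
    sum_boxWave_mul_boxWave_div_weight n,
    det_boxOp_eq_prod_cos n c m2,
    kingBoxGreen_eq_sum_boxWave n hc hm,
    det_foldOp_effLaplacian_eq_prod N n ha.le (by positivity) hm,
    log_gaussNorm_foldOp_effLaplacian N n ha (by positivity) hm,
    foldOp_effLaplacian_inv_apply_eq_sum_boxWave N n ha (by positivity) hm,
    dotProduct_blockCov_box_bounds n N ha (by positivity) hm,
    abs_log_det_lapF_dbl_div_card_sub_box_le n hc hm,
    abs_log_det_effLaplacian_dbl_div_card_sub_box_le N n (NeZero.one_le) ha hm,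
    kingFreeEnergyInf_eq_halfZoneIntegral hc hm⟩

/-- ★★★ **PART Ϟ BY NAME — THE FREE-BOUNDARY THERMODYNAMIC LIMITS ARE THE PERIODIC ONES** (along any boxes with all sides `→ ∞`). [cite: King1986, (3.89)–(3.93) pp.668–669, §4 p.670 l.8–13] -/
theorem king_box_spectral_limits (N : ℕ) [NeZero N] {a c m2 : ℝ} (ha : 0 < a) (hc : 0 ≤ c) (hm : 0 < m2) (nseq : ℕ → Fin (d + 1) → ℕ) (hpos : ∀ j ν, 0 < nseq j ν)
    (hlim : ∀ ν, Tendsto (fun j => (nseq j ν : ℝ)) atTop atTop) :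
    -- (1) the free energy density with free boundary conditions
    Tendsto (fun j => haveI : ∀ ν, NeZero (nseq j ν) := fun ν => ⟨(hpos j ν).ne'⟩
      (Fintype.card (KingBox (nseq j)) : ℝ)⁻¹ * Real.log (boxOp (nseq j) c m2).det) atTop (𝓝 (kingFreeEnergyInf c m2 d)) ∧
    -- (2) the RG block-field free energy density with free boundary conditions
    Tendsto (fun j => haveI : ∀ ν, NeZero (nseq j ν) := fun ν => ⟨(hpos j ν).ne'⟩
      (Fintype.card (KingBox (nseq j)) : ℝ)⁻¹ * Real.log (foldOp (nseq j) (effLaplacian N (dblPer (nseq j)) a ((N : ℝ) ^ 2) m2)).det) atTop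
      (𝓝 (bzMean (fun p : Fin (d + 1) → ℝ => Real.log (DeltaEff a N m2 p)) d)) ∧
    -- (3) King's normalisation per site with free boundary conditions
    Tendsto (fun j => haveI : ∀ ν, NeZero (nseq j ν) := fun ν => ⟨(hpos j ν).ne'⟩
      (Fintype.card (KingBox (nseq j)) : ℝ)⁻¹ * Real.log (gaussNorm (foldOp (nseq j) (effLaplacian N (dblPer (nseq j)) a ((N : ℝ) ^ 2) m2)))) atTop
      (𝓝 (1 / 2 * Real.log (2 * Real.pi) - 1 / 2 * bzMean (fun p : Fin (d + 1) → ℝ => Real.log (DeltaEff a N m2 p)) d)) :=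
  ⟨tendsto_log_det_boxOp_div_card hc hm nseq hpos hlim,
    tendsto_log_det_foldOp_effLaplacian_div_card N (NeZero.one_le) ha hm nseq hpos hlim,
    tendsto_log_gaussNorm_foldOp_effLaplacian_div_card N (NeZero.one_le) ha hm nseq hpos hlim⟩

/-- ★★★ **PART Ϟ BY NAME — THE `η`-RATES ON `Ω`** (`L` odd `≥ 2`, `a, m² > 0`, `K ≥ 1`, King's coupling `a_K`). [cite: King1986, (3.93) p.669, Lemma 4.3 (4.18) p.672, §4 p.670 l.8–13] -/
theorem king_box_spectral_rates (L : ℕ) (n : Fin (d + 1) → ℕ) [∀ μ, NeZero (n μ)] (hLodd : Odd L) (hL : 2 ≤ L) {a m2 : ℝ} (ha : 0 < a) (hm : 0 < m2) {K : ℕ} (hK : 1 ≤ K)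
    (nseq : ℕ → Fin (d + 1) → ℕ) (hpos : ∀ j ν, 0 < nseq j ν) (hlim : ∀ ν, Tendsto (fun j => (nseq j ν : ℝ)) atTop atTop) :
    haveI : NeZero L := ⟨by omega⟩
    -- (1) King's (3.93) on Ω
    (|Real.log (gaussNorm (foldOp n (effLaplacian (L ^ K) (dblPer n) (aK a L K) (((L ^ K : ℕ) : ℝ) ^ 2) m2)))
        - Real.log (gaussNorm (foldOp n (Matrix.of fun b b' => effLaplacianLim L (dblPer n) a m2 b b')))|
      ≤ 1 / 2 * ((Fintype.card (KingBox n) : ℝ) * (((aInf a L)⁻¹ + m2⁻¹) * (8 / 3 * (a ^ 2 * (a⁻¹ + Real.pi ^ 2 / 48 + 1 / 3)) + 4 / 3 * a))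
        * ((L : ℝ) ^ (2 * K))⁻¹)) ∧
    -- (2) NE2's unit layer on Ω in operator norm, rate `L^{−2K}`
    (∀ f : KingBox n → ℝ,
      (((foldOp n (effLaplacian (L ^ K) (dblPer n) (aK a L K) (((L ^ K : ℕ) : ℝ) ^ 2) m2))⁻¹ - (foldOp n (Matrix.of fun b b' => effLaplacianLim L (dblPer n) a m2 b b'))⁻¹) *ᵥ f)
          ⬝ᵥ (((foldOp n (effLaplacian (L ^ K) (dblPer n) (aK a L K) (((L ^ K : ℕ) : ℝ) ^ 2) m2))⁻¹ - (foldOp n (Matrix.of fun b b' => effLaplacianLim L (dblPer n) a m2 b b'))⁻¹) *ᵥ f)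
        ≤ ((((aInf a L)⁻¹ + m2⁻¹) ^ 2 * (8 / 3 * (a ^ 2 * (a⁻¹ + Real.pi ^ 2 / 48 + 1 / 3)) + 4 / 3 * a)) * ((L : ℝ) ^ (2 * K))⁻¹) ^ 2 * (f ⬝ᵥ f)) ∧
    -- (3) the continuum effective Laplacian's free energy density on Ω
    Tendsto (fun j => haveI : ∀ ν, NeZero (nseq j ν) := fun ν => ⟨(hpos j ν).ne'⟩
      (Fintype.card (KingBox (nseq j)) : ℝ)⁻¹ * Real.log (foldOp (nseq j) (Matrix.of fun b b' => effLaplacianLim L (dblPer (nseq j)) a m2 b b')).det) atTop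
      (𝓝 (bzMean (fun p : Fin (d + 1) → ℝ => Real.log (effSymLim a L m2 p)) d)) := by
  haveI : NeZero L := ⟨by omega⟩
  exact ⟨abs_log_gaussNorm_foldOp_effLaplacian_sub_lim_le L n hLodd hL ha hm hK,
    blockCov_box_sub_lim_mulVec_sq_le L n hLodd hL ha hm hK,
    tendsto_log_det_foldOp_effLaplacianLim_div_card L hLodd hL ha hm nseq hpos hlim⟩

end Summit.QuantumFields.YangMills.BalabanUVNodes.N15KingModelRung.TorusSpectral

end
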